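import Literature.AlgebraicGeometry.Resolution.FiniteCoverFormalFibres
import Literature.AlgebraicGeometry.Resolution.GRingPolynomialKernelCharZero
import Literature.AlgebraicGeometry.Resolution.SemiGenericFormalFibresPolynomial
import Mathlib.RingTheory.IsTensorProduct
import Mathlib.RingTheory.PolynomialAlgebra
import Mathlib.FieldTheory.IntermediateField.Adjoin.Basic
import HarnessLib

/-!
# Grothendieck's theorem on G-rings (Stacks 07PV), the kernel: the fibres over `𝔯 ≠ 0`
# (Stacks 07PU) in any characteristic

Topic: `Literature/AlgebraicGeometry/Resolution`. The case `𝔯 ≠ (0)`, `𝔯 ∩ A = (0)` of the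
kernel `hker` of `GRingPolynomialCoreReduction.lean` WITHOUT the characteristic-zero hypothesis of
`GRingPolynomialKernelCharZero.lean`, i.e. The Stacks Project, Tag 07PU (Lemma 15.51.9), end of
proof: for a regular local domain `A` with fraction field `K`, a prime `Q` of `A[x]`, a prime
`𝔭 = 𝔯A[x]_Q` of `S = A[x]_Q` with `0 ≠ 𝔯`, `𝔯 ∩ A = 0`, and a finite extension `L` of `κ(𝔭)`
(a finite extension of `K`), the ring `L ⊗_S Ŝ` is regular — GIVEN that `L' ⊗_A Ŝ` is regular
for all finite extensions `L'/K` ("semi-generic formal fibres", Stacks 07PR for `A[x]`,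
`SemiGenericFormalFibresPolynomial.lean`; kept here as an explicit hypothesis `hSG`).

Proof (Stacks 07PU: "In this case we see that `𝔯K[x]` is generated by `x - f` for some `f ∈ K`
… The derivation `D = d/dx` … maps `x - f` to a unit … We conclude by Lemma 15.49.2", made to work
over `A` rather than `K`, as in Matsumura's proof of Thm. 32.5, p. 260): choose a finite
`A`-subalgebra `B ⊆ L` with `Frac B = L` containing `a₀ = r₀ x̄` (`r₀ ∈ A ∖ 0`, `x̄` the image of
`x`); let `C = S ⊗_{A[x]} B[x]`, a localisation of `B[x]`, finite over `S`, mapping onto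
`S[B] ⊆ L` with kernel `𝔨 ∋ g = r₀ x - a₀` of height one. Then `L ⊗_S Ŝ = Π_𝔫 L ⊗_C (C_𝔫)^`
(Stacks 07N9; `FiniteCoverFormalFibres.lean`); the factors with `𝔨 ⊄ 𝔫` vanish, and for `𝔨 ⊆ 𝔫`
the factor is the fibre ring of `C → (C_𝔫)^` over `𝔨`, regular by Matsumura Thm. 30.4 (ii) with
the derivation `d/dx` of `B[x]` (extended to `(C_𝔫)^`, Stacks 07PE), `D(g) = r₀`, because
`(C_𝔫)^` is regular at the primes over `𝔨`: these avoid `B ∖ 0`, and `(B ∖ 0)⁻¹(C_𝔫)^` is a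
localisation of a factor of `(B ∖ 0)⁻¹(B ⊗_A Ŝ) = L ⊗_A Ŝ`, regular by `hSG`.
Everything is PROVED; no new notions, no named facts.

## Content (namespace `Literature.AlgebraicGeometry.Resolution`)

* `Polynomial.height_eq_one_of_ne_bot_of_under_eq_bot` — a nonzero prime `𝔯` of `B[x]` with
  `𝔯 ∩ B = 0` (`B` a domain) has height one.
* `module_finite_residueField_polynomial_of_ne_bot` — `κ(𝔯A[x]_Q)` is finite over `K`.
* `isRegularRing_tensor_completion_polynomial_of_subalgebra` — the computation above.
* `isGeometricallyRegular_fibre_polynomial_of_ne_bot`,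
  `hasGeomRegularGenericFormalFibre_polynomial_quotient_of_ne_bot` — **Stacks 07PU, the case
  `𝔯 ≠ 0`, in any characteristic** (under `hSG`).

## Sources

* The Stacks Project, Tag 07PU (Lemma 15.51.9), proof; Tags 07N9, 07PE, 07PN. [StacksProject]
* H. Matsumura, *Commutative Ring Theory*, CUP 1986, Thm. 30.4 (ii) p. 233; proof of Thm. 32.5
  p. 260. [Matsumura1987]
-/

noncomputable section

open IsLocalRing TensorProduct Polynomial

namespace Literature.AlgebraicGeometry.Resolution

universe u

/-! ## Height-one primes of `B[x]` -/

/-- **A nonzero prime `𝔯` of `B[x]` with `𝔯 ∩ B = 0` has height one** (`B` a domain with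
fraction field `L`): `𝔯L[x]` is a nonzero prime of the principal ideal domain `L[x]`, and
`ht 𝔯 = ht 𝔯L[x]` (localisation at `B ∖ 0`). [folklore] -/
theorem Polynomial.height_eq_one_of_ne_bot_of_under_eq_bot (B : Type u) [CommRing B] [IsDomain B]
    (r : Ideal B[X]) [r.IsPrime] (hr0 : r ≠ ⊥) (hrB : r.under B = ⊥) : r.height = 1 := by
  classical
  let L := FractionRing B
  letI : Algebra B[X] L[X] := Polynomial.algebra B L
  let M : Submonoid B[X] := (nonZeroDivisors B).map (Polynomial.C : B →+* B[X])
  haveI : IsLocalization M L[X] := Polynomial.isLocalization (nonZeroDivisors B) L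
  have hmemM : ∀ {m : B[X]}, m ∈ M → ∃ s : B, s ≠ 0 ∧ Polynomial.C s = m := fun hm => by
    obtain ⟨s, hs, rfl⟩ := Submonoid.mem_map.mp hm
    exact ⟨s, nonZeroDivisors.ne_zero hs, rfl⟩
  have hCr : ∀ {s : B}, Polynomial.C s ∈ r → s = 0 := fun {s} hs => by
    have h : s ∈ r.under B := by
      rw [Ideal.under_def, Ideal.mem_comap, Polynomial.algebraMap_apply, Algebra.algebraMap_self,
        RingHom.id_apply]
      exact hs
    rw [hrB] at h
    exact (Submodule.mem_bot B).mp h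
  have hdisj : Disjoint (M : Set B[X]) (r : Set B[X]) := by
    rw [Set.disjoint_left]
    intro m hm hmr
    obtain ⟨s, hs, rfl⟩ := hmemM hm
    exact hs (hCr hmr)
  have hMle : M ≤ nonZeroDivisors B[X] := fun m hm => by
    obtain ⟨s, hs, rfl⟩ := hmemM hm
    exact mem_nonZeroDivisors_of_ne_zero (Polynomial.C_ne_zero.mpr hs)
  have hinj : Function.Injective (algebraMap B[X] L[X]) := IsLocalization.injective L[X] hMle
  set rL : Ideal L[X] := r.map (algebraMap B[X] L[X]) with hrL
  haveI : rL.IsPrime := IsLocalization.isPrime_of_isPrime_disjoint M L[X] r ‹_› hdisj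
  have hrLr : rL.comap (algebraMap B[X] L[X]) = r := by
    rw [← Ideal.under_def]
    exact IsLocalization.under_map_of_isPrime_disjoint M L[X] ‹r.IsPrime› hdisj
  have hrL0 : rL ≠ ⊥ := fun h => hr0 (by rw [← hrLr, h, Ideal.comap_bot_of_injective _ hinj])
  have hhtL : rL.height = 1 := by
    apply le_antisymm
    · have h1 : (rL.height : WithBot ℕ∞) ≤ ringKrullDim L[X] := Ideal.height_le_ringKrullDim_of_isPrime
      rw [IsPrincipalIdealRing.ringKrullDim_eq_one L[X] (Polynomial.not_isField L)] at h1
      exact_mod_cast h1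
    · rw [Order.one_le_iff_ne_zero]
      intro h0
      exact hrL0 (Ideal.height_eq_zero_iff_eq_bot.mp h0)
  rw [← IsLocalization.height_map_of_disjoint (S := L[X]) M r hdisj]
  exact hhtL

/-! ## `κ(𝔯A[x]_Q)` is a finite extension of `K = Frac A` -/

section Finiteness

variable (A : Type u) [CommRing A] (Q : Ideal A[X]) [Q.IsPrime] (S : Type u) [CommRing S]
  [Algebra A[X] S] [IsLocalization.AtPrime S Q] (r : Ideal A[X]) (hr0 : r ≠ ⊥)
  (hrA : r.under A = ⊥) (p : Ideal S) [p.IsPrime] (hpr : p.comap (algebraMap A[X] S) = r)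

include hrA hpr in
/-- `A → κ(𝔭)` is injective for `𝔭 ∩ A[x] = 𝔯`, `𝔯 ∩ A = 0`. [folklore] -/
theorem eq_zero_of_algebraMap_residueField_C_eq_zero (a : A)
    (ha : algebraMap S p.ResidueField
      (algebraMap A[X] S (Polynomial.C a)) = 0) : a = 0 := by
  rw [Ideal.algebraMap_residueField_eq_zero] at ha
  have h1 : Polynomial.C a ∈ r := by
    rw [← hpr, Ideal.mem_comap]
    exact ha
  have h2 : a ∈ r.under A := by
    rw [Ideal.under_def, Ideal.mem_comap, Polynomial.algebraMap_apply, Algebra.algebraMap_self,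
      RingHom.id_apply]
    exact h1
  rw [hrA] at h2
  exact (Submodule.mem_bot A).mp h2

include Q hr0 hpr in
/-- **`κ(𝔭)` is finite over `K = Frac A`** for `𝔭 ∩ A[x] = 𝔯 ≠ 0`, for any `K`-algebra structure
on `κ(𝔭)` compatible with `A → A[x] → A[x]_Q → κ(𝔭)` (one exists iff `𝔯 ∩ A = 0`): `κ(𝔭) = K(x̄)`
with `x̄`, the image of `x`, algebraic over `K` (a nonzero element of `𝔯` kills it). [folklore] -/
theorem module_finite_residueField_polynomial_of_ne_bot (K : Type u) [Field K] [Algebra A K]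
    [IsFractionRing A K] [Algebra K p.ResidueField]
    (hK : ∀ a : A, algebraMap K p.ResidueField (algebraMap A K a) =
      algebraMap S p.ResidueField
        (algebraMap A[X] S (Polynomial.C a))) :
    Module.Finite K p.ResidueField := by
  classical
  let κ := p.ResidueField
  -- `κ` as an `A[x]`- and an `A`-algebra; `x̄` the image of `x`
  letI : Algebra A[X] κ := ((algebraMap S κ).comp (algebraMap A[X] S)).toAlgebra
  haveI : IsScalarTower A[X] S κ := IsScalarTower.of_algebraMap_eq fun _ => rfl
  letI : Algebra A κ := ((algebraMap A[X] κ).comp (algebraMap A A[X])).toAlgebra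
  haveI : IsScalarTower A A[X] κ := IsScalarTower.of_algebraMap_eq fun _ => rfl
  haveI : IsScalarTower A K κ := IsScalarTower.of_algebraMap_eq fun a => by
    rw [hK a]
    rfl
  let φ : A[X] →ₐ[A] κ := IsScalarTower.toAlgHom A A[X] κ
  set xb : κ := algebraMap A[X] κ X with hxb
  have hφ : ∀ f : A[X], algebraMap A[X] κ f = aeval xb f := fun f => by
    have h : aeval (φ X) f = φ (aeval X f) := Polynomial.aeval_algHom_apply φ X f
    rw [Polynomial.aeval_X_left_apply] at h
    exact h.symm
  -- `x̄` is integral over `K`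
  obtain ⟨f, hfr, hf0⟩ := Submodule.exists_mem_ne_zero_of_ne_bot hr0
  have hint : IsIntegral K xb := by
    refine IsAlgebraic.isIntegral ⟨f.map (algebraMap A K), ?_, ?_⟩
    · exact (Polynomial.map_ne_zero_iff (IsFractionRing.injective A K)).mpr hf0
    · rw [Polynomial.aeval_map_algebraMap, ← hφ]
      change algebraMap S κ (algebraMap A[X] S f) = 0
      rw [Ideal.algebraMap_residueField_eq_zero, ← Ideal.mem_comap, hpr]
      exact hfr
  -- `κ = K(x̄)`
  let F : IntermediateField K κ := IntermediateField.adjoin K {xb}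
  have hF1 : ∀ f : A[X], algebraMap A[X] κ f ∈ F := fun f => by
    rw [hφ, ← Polynomial.aeval_map_algebraMap K]
    exact IntermediateField.algebra_adjoin_le_adjoin K {xb}
      (Polynomial.aeval_mem_adjoin_singleton K xb)
  have hF2 : ∀ y : S, algebraMap S κ y ∈ F := fun y => by
    obtain ⟨f, s, rfl⟩ := IsLocalization.exists_mk'_eq Q.primeCompl y
    have hs : algebraMap S κ (algebraMap A[X] S s) ≠ 0 :=
      ((IsLocalization.map_units S s).map (algebraMap S κ)).ne_zero
    have hmk : algebraMap S κ (IsLocalization.mk' S f s) =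
        algebraMap S κ (algebraMap A[X] S f) * (algebraMap S κ (algebraMap A[X] S s))⁻¹ := by
      rw [eq_mul_inv_iff_mul_eq₀ hs, ← map_mul, IsLocalization.mk'_spec]
    rw [hmk]
    exact F.mul_mem (hF1 f) (F.inv_mem (hF1 s))
  have hF : F = ⊤ := by
    rw [eq_top_iff]
    intro z _
    obtain ⟨a, b, -, rfl⟩ := IsFractionRing.div_surjective (A := S ⧸ p) z
    obtain ⟨a, rfl⟩ := Ideal.Quotient.mk_surjective a
    obtain ⟨b, rfl⟩ := Ideal.Quotient.mk_surjective b
    rw [Ideal.algebraMap_quotient_residueField_mk, Ideal.algebraMap_quotient_residueField_mk]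
    exact F.div_mem (hF2 a) (hF2 b)
  -- hence finite
  haveI : FiniteDimensional K F := IntermediateField.adjoin.finiteDimensional hint
  refine Module.Finite.of_surjective (F.val.toLinearMap) fun z => ?_
  have hz : z ∈ F := by rw [hF]; trivial
  exact ⟨⟨z, hz⟩, rfl⟩

end Finiteness

/-! ## The computation: `L ⊗_S Ŝ` is regular -/

section Key

variable (A : Type u) [CommRing A] [IsNoetherianRing A] (Q : Ideal A[X]) [Q.IsPrime]
  (S : Type u) [CommRing S] [IsLocalRing S] [Algebra A[X] S] [IsLocalization.AtPrime S Q]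
  [Algebra A S] [IsScalarTower A A[X] S]
  (L : Type u) [Field L] [Algebra A[X] L] [Algebra A L] [IsScalarTower A A[X] L]
  [Algebra S L] [IsScalarTower A[X] S L]
  (B : Subalgebra A L) [IsFractionRing B L]
  (r₀ : A) (hr₀ : r₀ ≠ 0) (hx : r₀ • algebraMap A[X] L X ∈ B)
  (hinj : Function.Injective (algebraMap A L))
  (hSG : IsRegularRing (L ⊗[A] AdicCompletion (maximalIdeal S) S))
  (C : Type u) [CommRing C] [Algebra A[X] C] [Algebra S C] [IsScalarTower A[X] S C]
  [Module.Finite S C] [Algebra B[X] C]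
  (hBC : ∀ f : A[X], algebraMap B[X] C (f.map (algebraMap A B)) = algebraMap A[X] C f)
  [IsLocalization (Q.primeCompl.map (Polynomial.mapRingHom (algebraMap A B) : A[X] →+* B[X])) C]

include Q hSG hBC in
omit [IsNoetherianRing A] [Algebra A[X] L] [IsScalarTower A A[X] L] [Algebra S L]
  [IsScalarTower A[X] S L] [Module.Finite S C] in
/-- **The local rings of `C ⊗_S Ŝ` at the primes avoiding `B ∖ 0` are regular** when `L ⊗_A Ŝ`
is (`L = Frac B`): `C ⊗_S Ŝ ≅ Ŝ ⊗_A B` (as `C = S ⊗_{A[x]} B[x]` and `B[x] = A[x] ⊗_A B`), whose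
localisation at `B ∖ 0` is `(Ŝ ⊗_A B) ⊗_B L ≅ L ⊗_A Ŝ`. [cite: StacksProject, Tag 07PU (proof)] -/
theorem isRegularLocalRing_localization_tensor_completion_of_forall_not_mem
    (𝔓 : Ideal (C ⊗[S] (AdicCompletion (maximalIdeal S) S))) [𝔓.IsPrime]
    (h𝔓 : ∀ b ∈ nonZeroDivisors B,
      algebraMap C (C ⊗[S] (AdicCompletion (maximalIdeal S) S)) (algebraMap B[X] C (Polynomial.C b)) ∉ 𝔓) :
    IsRegularLocalRing (Localization.AtPrime 𝔓) := by
  classical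
  haveI : IsScalarTower A[X] S (AdicCompletion (maximalIdeal S) S) := IsScalarTower.of_algebraMap_eq fun f => by
    rw [AdicCompletion.algebraMap_apply, AdicCompletion.algebraMap_apply, Algebra.algebraMap_self,
      RingHom.id_apply]
  letI : Algebra A[X] B[X] := Polynomial.algebra A B
  have halgBX : ∀ f : A[X], algebraMap A[X] B[X] f = f.map (algebraMap A B) := fun f => rfl
  haveI : IsScalarTower A[X] B[X] C := IsScalarTower.of_algebraMap_eq fun f => by
    rw [halgBX, hBC]
  haveI hCloc : IsLocalization (Algebra.algebraMapSubmonoid B[X] Q.primeCompl) C :=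
    ‹IsLocalization (Q.primeCompl.map (Polynomial.mapRingHom (algebraMap A B) : A[X] →+* B[X])) C›
  haveI : Algebra.IsPushout A[X] S B[X] C :=
    (Algebra.isPushout_of_isLocalization (R := A[X]) Q.primeCompl S B[X] C).symm
  let iB : B →+* C := (algebraMap B[X] C).comp Polynomial.C
  replace h𝔓 : ∀ b ∈ nonZeroDivisors B, algebraMap C (C ⊗[S] (AdicCompletion (maximalIdeal S) S)) (iB b) ∉ 𝔓 := h𝔓
  -- `e : C ⊗_S Ŝ ≃ Ŝ ⊗_A B`
  let eC : C ≃ₐ[S] S ⊗[A[X]] B[X] := (Algebra.IsPushout.equiv A[X] S B[X] C).symm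
  let eP : B[X] ≃ₐ[A[X]] A[X] ⊗[A] B := (Algebra.IsPushout.equiv A A[X] B B[X]).symm
  let e₀ := Algebra.TensorProduct.congr eC (AlgEquiv.refl (R := S) (A₁ := (AdicCompletion (maximalIdeal S) S)))
  let e₁ := Algebra.TensorProduct.comm S (S ⊗[A[X]] B[X]) (AdicCompletion (maximalIdeal S) S)
  let e₂ := Algebra.TensorProduct.cancelBaseChange A[X] S S (AdicCompletion (maximalIdeal S) S) B[X]
  let e₃ := Algebra.TensorProduct.congr (AlgEquiv.refl (R := A[X]) (A₁ := (AdicCompletion (maximalIdeal S) S))) eP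
  let e₄ := Algebra.TensorProduct.cancelBaseChange A A[X] A[X] (AdicCompletion (maximalIdeal S) S) B
  let e : C ⊗[S] (AdicCompletion (maximalIdeal S) S) ≃+* (AdicCompletion (maximalIdeal S) S) ⊗[A] B :=
    e₀.toRingEquiv.trans (e₁.toRingEquiv.trans
      (e₂.toRingEquiv.trans (e₃.toRingEquiv.trans e₄.toRingEquiv)))
  have he : ∀ b : B, e (algebraMap C (C ⊗[S] (AdicCompletion (maximalIdeal S) S)) (iB b)) = (1 : (AdicCompletion (maximalIdeal S) S)) ⊗ₜ[A] b := by
    intro b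
    have h0 : algebraMap C (C ⊗[S] (AdicCompletion (maximalIdeal S) S)) (iB b) =
        (algebraMap B[X] C (Polynomial.C b : B[X])) ⊗ₜ[S] (1 : (AdicCompletion (maximalIdeal S) S)) := by
      rw [Algebra.TensorProduct.algebraMap_apply, Algebra.algebraMap_self, RingHom.id_apply]
      rfl
    have hCb : (Polynomial.C b : B[X]) = algebraMap B B[X] b := by
      rw [Polynomial.algebraMap_apply, Algebra.algebraMap_self, RingHom.id_apply]
    have s0 : e₀ ((algebraMap B[X] C (Polynomial.C b : B[X])) ⊗ₜ[S] (1 : (AdicCompletion (maximalIdeal S) S))) =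
        ((1 : S) ⊗ₜ[A[X]] (Polynomial.C b : B[X])) ⊗ₜ[S] (1 : (AdicCompletion (maximalIdeal S) S)) := by
      change Algebra.TensorProduct.congr eC (AlgEquiv.refl (R := S) (A₁ := (AdicCompletion (maximalIdeal S) S))) (_ ⊗ₜ _) = _
      rw [Algebra.TensorProduct.congr_apply, Algebra.TensorProduct.map_tmul]
      change eC (algebraMap B[X] C (Polynomial.C b)) ⊗ₜ[S] (1 : (AdicCompletion (maximalIdeal S) S)) = _
      rw [Algebra.IsPushout.equiv_symm_algebraMap_right A[X] S B[X] C]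
    have s1 : e₁ (((1 : S) ⊗ₜ[A[X]] (Polynomial.C b : B[X])) ⊗ₜ[S] (1 : (AdicCompletion (maximalIdeal S) S))) =
        (1 : (AdicCompletion (maximalIdeal S) S)) ⊗ₜ[S] ((1 : S) ⊗ₜ[A[X]] (Polynomial.C b : B[X])) :=
      Algebra.TensorProduct.comm_tmul _ _ _
    have s2 : e₂ ((1 : (AdicCompletion (maximalIdeal S) S)) ⊗ₜ[S] ((1 : S) ⊗ₜ[A[X]] (Polynomial.C b : B[X]))) =
        (1 : (AdicCompletion (maximalIdeal S) S)) ⊗ₜ[A[X]] (Polynomial.C b : B[X]) := by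
      change Algebra.TensorProduct.cancelBaseChange A[X] S S (AdicCompletion (maximalIdeal S) S) B[X] _ = _
      rw [Algebra.TensorProduct.cancelBaseChange_tmul, one_smul]
    have s3 : e₃ ((1 : (AdicCompletion (maximalIdeal S) S)) ⊗ₜ[A[X]] (Polynomial.C b : B[X])) =
        (1 : (AdicCompletion (maximalIdeal S) S)) ⊗ₜ[A[X]] ((1 : A[X]) ⊗ₜ[A] b) := by
      change Algebra.TensorProduct.congr (AlgEquiv.refl (R := A[X]) (A₁ := (AdicCompletion (maximalIdeal S) S))) eP (_ ⊗ₜ _) = _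
      rw [Algebra.TensorProduct.congr_apply, Algebra.TensorProduct.map_tmul]
      change (1 : (AdicCompletion (maximalIdeal S) S)) ⊗ₜ[A[X]] eP (Polynomial.C b) = _
      rw [hCb, Algebra.IsPushout.equiv_symm_algebraMap_right A A[X] B B[X] b]
    have s4 : e₄ ((1 : (AdicCompletion (maximalIdeal S) S)) ⊗ₜ[A[X]] ((1 : A[X]) ⊗ₜ[A] b)) = (1 : (AdicCompletion (maximalIdeal S) S)) ⊗ₜ[A] b := by
      change Algebra.TensorProduct.cancelBaseChange A A[X] A[X] (AdicCompletion (maximalIdeal S) S) B _ = _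
      rw [Algebra.TensorProduct.cancelBaseChange_tmul, one_smul]
    rw [h0]
    change e₄ (e₃ (e₂ (e₁ (e₀ _)))) = _
    rw [s0, s1, s2, s3, s4]
  -- `(Ŝ ⊗_A B) ⊗_B L ≅ L ⊗_A Ŝ` is regular, and is the localisation of `Ŝ ⊗_A B` at `B ∖ 0`
  letI : Algebra B ((AdicCompletion (maximalIdeal S) S) ⊗[A] B) := Algebra.TensorProduct.rightAlgebra
  haveI : IsLocalization (Algebra.algebraMapSubmonoid ((AdicCompletion (maximalIdeal S) S) ⊗[A] B) (nonZeroDivisors B))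
      (((AdicCompletion (maximalIdeal S) S) ⊗[A] B) ⊗[B] L) := IsLocalization.tensor L (nonZeroDivisors B)
  haveI : IsRegularRing (((AdicCompletion (maximalIdeal S) S) ⊗[A] B) ⊗[B] L) := by
    let f₁ := Algebra.TensorProduct.comm B ((AdicCompletion (maximalIdeal S) S) ⊗[A] B) L
    let f₂ := Algebra.TensorProduct.congr (AlgEquiv.refl (R := B) (A₁ := L))
      (Algebra.TensorProduct.commRight A B (AdicCompletion (maximalIdeal S) S)).symm
    let f₃ := Algebra.TensorProduct.cancelBaseChange A B B L (AdicCompletion (maximalIdeal S) S)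
    exact IsRegularRing.of_ringEquiv (R := L ⊗[A] (AdicCompletion (maximalIdeal S) S)) (f₁.trans (f₂.trans f₃)).symm.toRingEquiv
  -- `𝔓' = e(𝔓)` avoids `B ∖ 0`
  let e' : (AdicCompletion (maximalIdeal S) S) ⊗[A] B ≃+* C ⊗[S] (AdicCompletion (maximalIdeal S) S) := e.symm
  haveI : (𝔓.comap e').IsPrime := Ideal.comap_isPrime e' 𝔓
  have h𝔓' : Disjoint ((Algebra.algebraMapSubmonoid ((AdicCompletion (maximalIdeal S) S) ⊗[A] B) (nonZeroDivisors B) :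
      Submonoid ((AdicCompletion (maximalIdeal S) S) ⊗[A] B)) : Set ((AdicCompletion (maximalIdeal S) S) ⊗[A] B)) (𝔓.comap e') := by
    rw [Set.disjoint_left]
    rintro _ ⟨b, hb, rfl⟩ hmem
    refine h𝔓 b hb ?_
    have h1 : e' ((1 : (AdicCompletion (maximalIdeal S) S)) ⊗ₜ[A] (b : B)) = algebraMap C (C ⊗[S] (AdicCompletion (maximalIdeal S) S)) (iB b) := by
      rw [← he, RingEquiv.symm_apply_apply]
    rw [← h1]
    exact hmem
  haveI := isRegularLocalRing_localization_of_isLocalization_of_disjoint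
    (W := ((AdicCompletion (maximalIdeal S) S) ⊗[A] B) ⊗[B] L) (Algebra.algebraMapSubmonoid ((AdicCompletion (maximalIdeal S) S) ⊗[A] B) (nonZeroDivisors B))
    (𝔓.comap e') h𝔓'
  exact IsRegularLocalRing.of_ringEquiv (R := Localization.AtPrime (𝔓.comap e'))
    (IsLocalization.ringEquivOfRingEquiv (Localization.AtPrime (𝔓.comap e'))
      (Localization.AtPrime 𝔓) e' (e'.map_primeCompl_comap_eq 𝔓))


include Q hr₀ hx hinj hSG hBC in
/-- **Stacks 07PU over `A`: `L ⊗_S Ŝ` is regular.** Let `A` be a Noetherian domain, `Q` a prime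
of `A[x]`, `S = A[x]_Q` (any localisation of `A[x]` at `Q`), `Ŝ` its completion, and `L` a field
which is an `S`-algebra such that `L = Frac B` for a finite `A`-subalgebra `B ⊆ L` containing
`r₀ x̄` (`r₀ ∈ A ∖ 0`, `x̄` the image of `x`), with `A → L` injective; let
`C = S ⊗_{A[x]} B[x]` (any localisation of `B[x]` at the image of `A[x] ∖ Q`, with its
`S`-algebra structure). If `L ⊗_A Ŝ` is a regular ring, then so is `L ⊗_S Ŝ`. (`C → L` has kernel
`𝔨 ∋ g = r₀x - r₀x̄` of height one; `L ⊗_S Ŝ = Π_𝔫 L ⊗_C (C_𝔫)^`; the factors with `𝔨 ⊄ 𝔫` vanish;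
for `𝔨 ⊆ 𝔫` the factor is `κ(𝔨) ⊗_C (C_𝔫)^`, regular by Thm. 30.4 (ii) with `d/dx`, `D(g) = r₀`,
at the primes over `𝔨`, where `(C_𝔫)^` is regular because they avoid `B ∖ 0` and
`(B ∖ 0)⁻¹(C ⊗_S Ŝ) = L ⊗_A Ŝ`.) [cite: StacksProject, Tag 07PU (proof)] -/
theorem isRegularRing_tensor_completion_polynomial_of_isLocalization :
    IsRegularRing (L ⊗[S] (AdicCompletion (maximalIdeal S) S)) := by
  classical
  haveI : IsNoetherianRing S := IsLocalization.isNoetherianRing Q.primeCompl S inferInstance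
  haveI : IsNoetherianRing (AdicCompletion (maximalIdeal S) S) := isNoetherianRing_adicCompletion_maximalIdeal S
  haveI : IsScalarTower A[X] S (AdicCompletion (maximalIdeal S) S) := IsScalarTower.of_algebraMap_eq fun f => by
    rw [AdicCompletion.algebraMap_apply, AdicCompletion.algebraMap_apply, Algebra.algebraMap_self,
      RingHom.id_apply]
  -- `A → B → L` are injective
  have hinjB : Function.Injective (algebraMap A B) := fun a b hab =>
    hinj (by simpa using congrArg (fun y : B => (y : L)) hab)
  have hBL : Function.Injective (algebraMap B L) := Subtype.val_injective
  -- `B[x]` over `A[x]`; `C` is the localisation of `B[x]` at the image `M` of `A[x] ∖ Q`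
  letI : Algebra A[X] B[X] := Polynomial.algebra A B
  have halgBX : ∀ f : A[X], algebraMap A[X] B[X] f = f.map (algebraMap A B) := fun f => rfl
  haveI : IsScalarTower A[X] B[X] C := IsScalarTower.of_algebraMap_eq fun f => by
    rw [halgBX, hBC]
  haveI hCloc : IsLocalization (Algebra.algebraMapSubmonoid B[X] Q.primeCompl) C :=
    ‹IsLocalization (Q.primeCompl.map (Polynomial.mapRingHom (algebraMap A B) : A[X] →+* B[X])) C›
  have hMle : Algebra.algebraMapSubmonoid B[X] Q.primeCompl ≤ nonZeroDivisors B[X] := by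
    rintro _ ⟨f, hf, rfl⟩
    refine mem_nonZeroDivisors_of_ne_zero ?_
    rw [halgBX]
    exact (Polynomial.map_ne_zero_iff hinjB).mpr fun h0 => hf (h0 ▸ Q.zero_mem)
  haveI : IsDomain C := IsLocalization.isDomain_of_le_nonZeroDivisors C hMle
  haveI : IsNoetherianRing C := isNoetherian_of_tower S (inferInstance : IsNoetherian S C)
  haveI : Algebra.IsPushout A[X] S B[X] C :=
    (Algebra.isPushout_of_isLocalization (R := A[X]) Q.primeCompl S B[X] C).symm
  -- `A → C`, `iB : B → C`
  letI : Algebra A C := ((algebraMap A[X] C).comp (algebraMap A A[X])).toAlgebra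
  haveI : IsScalarTower A A[X] C := IsScalarTower.of_algebraMap_eq fun _ => rfl
  haveI : IsScalarTower A B[X] C := IsScalarTower.of_algebraMap_eq fun a => by
    rw [IsScalarTower.algebraMap_apply A A[X] C, IsScalarTower.algebraMap_apply A A[X] B[X],
      IsScalarTower.algebraMap_apply A[X] B[X] C]
  let iB : B →+* C := (algebraMap B[X] C).comp Polynomial.C
  have halgB : ∀ b : B, iB b = algebraMap B[X] C (Polynomial.C b) := fun b => rfl
  -- the map `ψ : C → L`, `y ⊗ q ↦ y · q(x̄)`
  let xb : L := algebraMap A[X] L X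
  let a₀ : B := ⟨r₀ • xb, hx⟩
  let φ : A[X] →ₐ[A] L := IsScalarTower.toAlgHom A A[X] L
  have hφ : ∀ f : A[X], algebraMap A[X] L f = aeval xb f := fun f => by
    have h : aeval (φ X) f = φ (aeval X f) := Polynomial.aeval_algHom_apply φ X f
    rw [Polynomial.aeval_X_left_apply] at h
    exact h.symm
  let gB : B[X] →ₐ[A[X]] L :=
    { (Polynomial.aeval xb : B[X] →ₐ[B] L).toRingHom with
      commutes' := fun f => by
        change aeval xb (algebraMap A[X] B[X] f) = algebraMap A[X] L f
        rw [halgBX, Polynomial.aeval_map_algebraMap, hφ] }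
  have hgB : ∀ q : B[X], gB q = aeval xb q := fun _ => rfl
  let ψ : C →ₐ[A[X]] L :=
    Algebra.pushoutDesc C (IsScalarTower.toAlgHom A[X] S L) gB fun _ _ => mul_comm _ _
  have hψS : ∀ y : S, ψ (algebraMap S C y) = algebraMap S L y := fun y =>
    Algebra.pushoutDesc_left C (IsScalarTower.toAlgHom A[X] S L) gB _ y
  have hψX : ∀ q : B[X], ψ (algebraMap B[X] C q) = aeval xb q := fun q =>
    Algebra.pushoutDesc_right C (IsScalarTower.toAlgHom A[X] S L) gB _ q
  letI : Algebra C L := ψ.toRingHom.toAlgebra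
  have hψC : ∀ c : C, algebraMap C L c = ψ c := fun _ => rfl
  haveI : IsScalarTower S C L := IsScalarTower.of_algebraMap_eq (R := S) (A := L) fun y => by
    rw [hψC, hψS]
  have hψB : ∀ q : B[X], algebraMap C L (algebraMap B[X] C q) = aeval xb q := fun q => by
    rw [hψC, hψX]
  have hψb : ∀ b : B, algebraMap C L (iB b) = (b : L) := fun b => by
    rw [halgB, hψB, Polynomial.aeval_C]
    rfl
  -- the local rings of `C ⊗_S Ŝ ≅ Ŝ ⊗_A B` at primes avoiding `B ∖ 0` are regular (from `hSG`)
  have hregC := isRegularLocalRing_localization_tensor_completion_of_forall_not_mem A Q S L B hSG C hBC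
  -- apply the engine: the factors `L ⊗_C (C_𝔫)^`
  refine isRegularRing_tensor_adicCompletion_of_forall_maximal S C L fun n => ?_
  haveI := n.isMaximal
  let Cn := Localization.AtPrime n.asIdeal
  let X' := AdicCompletion (maximalIdeal Cn) Cn
  haveI : IsNoetherianRing Cn := IsLocalization.isNoetherianRing n.asIdeal.primeCompl Cn inferInstance
  haveI : IsNoetherianRing X' := isNoetherianRing_adicCompletion_maximalIdeal Cn
  haveI : IsScalarTower C Cn X' := isScalarTower_adicCompletion_localization C n.asIdeal
  haveI : Module.Flat C Cn := IsLocalization.flat Cn n.asIdeal.primeCompl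
  haveI : Module.Flat Cn X' := AdicCompletion.flat_of_isNoetherian _
  haveI : Module.Flat C X' := Module.Flat.trans C Cn X'
  set 𝔨 : Ideal C := RingHom.ker (algebraMap C L) with h𝔨def
  haveI : 𝔨.IsPrime := RingHom.ker_isPrime _
  by_cases hkn : 𝔨 ≤ n.asIdeal
  swap
  · -- the factor vanishes
    obtain ⟨c, hc𝔨, hcn⟩ := SetLike.not_le_iff_exists.mp hkn
    have hu : IsUnit (algebraMap C X' c) := by
      rw [IsScalarTower.algebraMap_apply C Cn X']
      exact (IsLocalization.map_units Cn (⟨c, hcn⟩ : n.asIdeal.primeCompl)).map _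
    haveI := subsingleton_tensor_of_isUnit (M := L) c (RingHom.mem_ker.mp hc𝔨) hu
    exact isRegularRing_of_subsingleton _
  -- the factor is the fibre ring over `𝔨`
  have hfrac : ∀ ℓ : L, ∃ a b : C, algebraMap C L b ≠ 0 ∧ ℓ * algebraMap C L b = algebraMap C L a := by
    intro ℓ
    obtain ⟨⟨a, s⟩, h⟩ := IsLocalization.surj (nonZeroDivisors B) ℓ
    refine ⟨iB a, iB s, ?_, ?_⟩
    · rw [hψb]
      exact (map_ne_zero_iff _ hBL).mpr (nonZeroDivisors.ne_zero s.2)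
    · rw [hψb, hψb]
      exact h
  refine isRegularRing_tensor_of_isRegularRing_fiber 𝔨 L h𝔨def.symm hfrac X' ?_
  -- `𝔨 = 𝔯'C` with `𝔯' = ker (B[x] → L)` of height one
  let r' : Ideal B[X] := RingHom.ker (gB : B[X] →+* L)
  haveI : r'.IsPrime := RingHom.ker_isPrime _
  have hmemr' : ∀ q : B[X], q ∈ r' ↔ aeval xb q = 0 := fun q => RingHom.mem_ker
  have h𝔨r' : 𝔨.under B[X] = r' := by
    ext q
    rw [Ideal.under_def, Ideal.mem_comap, h𝔨def, RingHom.mem_ker, hψB, hmemr']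
  have h𝔨map : r'.map (algebraMap B[X] C) = 𝔨 := by
    rw [← h𝔨r']
    exact IsLocalization.map_under (Algebra.algebraMapSubmonoid B[X] Q.primeCompl) C 𝔨
  have hr'B : r'.under B = ⊥ := by
    refine eq_bot_iff.mpr fun b hb => ?_
    rw [Ideal.under_def, Ideal.mem_comap, hmemr', Polynomial.algebraMap_apply, Algebra.algebraMap_self,
      RingHom.id_apply, Polynomial.aeval_C] at hb
    exact (Submodule.mem_bot B).mpr (hBL (by rw [map_zero]; exact hb))
  let g₀ : B[X] := Polynomial.C (algebraMap A B r₀) * X - Polynomial.C a₀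
  have hg₀r' : g₀ ∈ r' := by
    rw [hmemr', map_sub, map_mul, Polynomial.aeval_C, Polynomial.aeval_X, Polynomial.aeval_C,
      ← IsScalarTower.algebraMap_apply, sub_eq_zero, ← Algebra.smul_def]
    rfl
  have hr₀B : algebraMap A B r₀ ≠ 0 := (map_ne_zero_iff _ hinjB).mpr hr₀
  have hg₀0 : g₀ ≠ 0 := fun h => by
    have h1 := congrArg (fun q : B[X] => q.coeff 1) h
    simp only [g₀, Polynomial.coeff_sub, Polynomial.coeff_C_mul_X, Polynomial.coeff_C_succ,
      Polynomial.coeff_zero, sub_zero] at h1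
    exact hr₀B h1
  have hr'0 : r' ≠ ⊥ := fun h => hg₀0 (by simpa [h] using hg₀r')
  have hr'ht : r'.height = 1 := Polynomial.height_eq_one_of_ne_bot_of_under_eq_bot B r' hr'0 hr'B
  have hdisj : Disjoint ((Algebra.algebraMapSubmonoid B[X] Q.primeCompl : Submonoid B[X]) :
      Set B[X]) (r' : Set B[X]) := by
    rw [Set.disjoint_left]
    rintro _ ⟨f, hf, rfl⟩ hfr'
    have h1 : gB (algebraMap A[X] B[X] f) = algebraMap A[X] L f := gB.commutes f
    have h2 : IsUnit (algebraMap A[X] L f) := by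
      rw [IsScalarTower.algebraMap_apply A[X] S L]
      exact (IsLocalization.map_units S ⟨f, hf⟩).map _
    have h3 : gB (algebraMap A[X] B[X] f) = 0 := hfr'
    exact h2.ne_zero (h1 ▸ h3)
  have hht : 𝔨.height = 1 := by
    rw [← h𝔨map, IsLocalization.height_map_of_disjoint (S := C) _ r' hdisj, hr'ht]
  -- `g ∈ 𝔨`
  let g : C := algebraMap B[X] C g₀
  have hg : g ∈ 𝔨 := by
    rw [← h𝔨map]
    exact Ideal.mem_map_of_mem _ hg₀r'
  -- the derivation `d/dx` of `B[x]`, on `C`, `C_𝔫`, `(C_𝔫)^`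
  obtain ⟨DC, hDC⟩ := exists_derivation_extend_of_isLocalization A C
    (Algebra.algebraMapSubmonoid B[X] Q.primeCompl)
    ((Polynomial.derivative' : Derivation B B[X] B[X]).restrictScalars A)
  obtain ⟨DCn, hDCn⟩ := exists_derivation_extend_of_isLocalization A Cn n.asIdeal.primeCompl DC
  obtain ⟨DZ, hDZ⟩ := exists_derivation_int_of_leibniz DCn.toLinearMap.toAddMonoidHom fun x y => by
    change DCn (x * y) = x * DCn y + y * DCn x
    rw [Derivation.leibniz, smul_eq_mul, smul_eq_mul]
  obtain ⟨DX, hDX₀⟩ := exists_derivation_adicCompletion_extend (maximalIdeal Cn) DZ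
  have hdg₀ : (Polynomial.derivative' : Derivation B B[X] B[X]).restrictScalars A g₀ =
      Polynomial.C (algebraMap A B r₀) := by
    change Polynomial.derivative g₀ = _
    simp only [g₀, Polynomial.derivative_sub, Polynomial.derivative_C_mul_X, Polynomial.derivative_C,
      sub_zero]
  have hDXg : DX (algebraMap C X' g) = algebraMap C X' (iB (algebraMap A B r₀)) := by
    rw [IsScalarTower.algebraMap_apply C Cn X' g, hDX₀, hDZ]
    change algebraMap Cn X' (DCn (algebraMap C Cn g)) = _
    rw [hDCn, hDC, hdg₀, ← IsScalarTower.algebraMap_apply C Cn X', halgB]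
  have hcL : algebraMap C L (iB (algebraMap A B r₀)) ≠ 0 := by
    rw [hψb]
    change algebraMap A L r₀ ≠ 0
    exact (map_ne_zero_iff _ hinj).mpr hr₀
  have hD : ∃ (v : X') (c : C), c ∉ 𝔨 ∧
      v * DX (algebraMap C X' g) - algebraMap C X' c ∈ Ideal.span {algebraMap C X' g} :=
    ⟨1, iB (algebraMap A B r₀), fun hc => hcL (RingHom.mem_ker.mp hc), by
      rw [one_mul, hDXg, sub_self]
      exact zero_mem _⟩
  -- `(C_𝔫)^` is regular at the primes over `𝔨` (they avoid `N = (C ∖ 𝔫)·(B ∖ 0)`)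
  have hreg : ∀ (𝔔 : Ideal X') [𝔔.IsPrime], 𝔔.under C = 𝔨 →
      IsRegularLocalRing (Localization.AtPrime 𝔔) := by
    intro 𝔔 _ h𝔔
    let N₀ : Submonoid C := (nonZeroDivisors B).map iB
    refine isRegularLocalRing_localization_completion_of_forall_disjoint S C n.asIdeal
      (n.asIdeal.primeCompl ⊔ N₀) le_sup_left (fun 𝔓 _ h𝔓 => hregC 𝔓 fun b hb =>
        h𝔓 _ (Submonoid.mem_sup_right ⟨b, hb, rfl⟩)) 𝔔 fun x hx hmem => ?_
    obtain ⟨y, hy, z, hz, rfl⟩ := Submonoid.mem_sup.mp hx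
    rw [map_mul] at hmem
    rcases ‹𝔔.IsPrime›.mem_or_mem hmem with h | h
    · have h1 : y ∈ 𝔨 := by
        rw [← h𝔔, Ideal.under_def, Ideal.mem_comap]
        exact h
      exact hy (hkn h1)
    · obtain ⟨b, hb, rfl⟩ := hz
      have h1 : iB b ∈ 𝔨 := by
        rw [← h𝔔, Ideal.under_def, Ideal.mem_comap]
        exact h
      have h2 : (b : L) = 0 := by
        rw [← hψb]
        exact RingHom.mem_ker.mp h1
      exact nonZeroDivisors.ne_zero hb (hBL (by rw [map_zero]; exact h2))
  exact isRegularRing_fiber_of_derivation' X' 𝔨 hht g hg DX hD hreg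

end Key

/-! ## Stacks 07PU: the fibres over `𝔯 ≠ 0` are geometrically regular -/

section Fibre

variable (A : Type u) [CommRing A] [IsDomain A] [IsNoetherianRing A] (Q : Ideal A[X]) [Q.IsPrime]
  (S : Type u) [CommRing S] [IsLocalRing S] [Algebra A[X] S] [IsLocalization.AtPrime S Q]
  [Algebra A S] [IsScalarTower A A[X] S]
  (hSG : ∀ (L : Type u) [Field L] [Algebra (FractionRing A) L] [Algebra A L]
    [IsScalarTower A (FractionRing A) L], FiniteDimensional (FractionRing A) L →
      IsRegularRing (L ⊗[A] AdicCompletion (maximalIdeal S) S))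
  (r : Ideal A[X]) (hr0 : r ≠ ⊥) (hrA : r.under A = ⊥)
  (p : Ideal S) [p.IsPrime] (hpr : p.comap (algebraMap A[X] S) = r)

include Q hSG hr0 hrA hpr in
/-- **Stacks 07PU: the fibre of `S = A[x]_Q → Ŝ` over `𝔭 = 𝔯S` (`0 ≠ 𝔯`, `𝔯 ∩ A = 0`) is
geometrically regular**, for a Noetherian domain `A` such that `L ⊗_A Ŝ` is regular for every
finite extension `L` of `Frac A` (semi-generic formal fibres; for a complete regular local `A` this
is Stacks 07PR for `A[x]`, `isRegularRing_tensor_completion_polynomial`): a finite extension `L` of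
`κ(𝔭)` is finite over `K = Frac A` (`module_finite_residueField_polynomial_of_ne_bot`), so
`L = Frac B` for a finite `A`-subalgebra `B ∋ r₀x̄`, and `L ⊗_{κ(𝔭)} (κ(𝔭) ⊗_S Ŝ) = L ⊗_S Ŝ` is
regular by `isRegularRing_tensor_completion_polynomial_of_isLocalization` with
`C = S ⊗_{A[x]} B[x]`. [cite: StacksProject, Tag 07PU] -/
theorem isGeometricallyRegular_fibre_polynomial_of_ne_bot :
    IsGeometricallyRegular p.ResidueField (p.Fiber (AdicCompletion (maximalIdeal S) S)) := by
  classical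
  intro L _ _ hL
  haveI := hL
  -- algebra structures on `L`: `A → A[x] → S → κ(𝔭) → L`
  letI : Algebra S L := ((algebraMap p.ResidueField L).comp (algebraMap S p.ResidueField)).toAlgebra
  haveI : IsScalarTower S p.ResidueField L := IsScalarTower.of_algebraMap_eq fun _ => rfl
  letI : Algebra A[X] L := ((algebraMap S L).comp (algebraMap A[X] S)).toAlgebra
  haveI : IsScalarTower A[X] S L := IsScalarTower.of_algebraMap_eq fun _ => rfl
  letI : Algebra A L := ((algebraMap A[X] L).comp (algebraMap A A[X])).toAlgebra
  haveI : IsScalarTower A A[X] L := IsScalarTower.of_algebraMap_eq fun _ => rfl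
  -- `A → κ(𝔭)` is injective; `K = Frac A → κ(𝔭) → L`
  let j : A →+* p.ResidueField :=
    (algebraMap S p.ResidueField).comp ((algebraMap A[X] S).comp (algebraMap A A[X]))
  have hj : Function.Injective j := (injective_iff_map_eq_zero j).mpr fun a ha =>
    eq_zero_of_algebraMap_residueField_C_eq_zero A S r hrA p hpr a ha
  letI : Algebra (FractionRing A) p.ResidueField := (IsFractionRing.lift hj).toAlgebra
  have hK : ∀ a : A, algebraMap (FractionRing A) p.ResidueField (algebraMap A (FractionRing A) a) =
      algebraMap S p.ResidueField (algebraMap A[X] S (Polynomial.C a)) := fun a =>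
    IsFractionRing.lift_algebraMap hj a
  haveI : Module.Finite (FractionRing A) p.ResidueField :=
    module_finite_residueField_polynomial_of_ne_bot A Q S r hr0 p hpr (FractionRing A) hK
  letI : Algebra (FractionRing A) L :=
    ((algebraMap p.ResidueField L).comp (algebraMap (FractionRing A) p.ResidueField)).toAlgebra
  haveI : IsScalarTower (FractionRing A) p.ResidueField L :=
    IsScalarTower.of_algebraMap_eq fun _ => rfl
  haveI : IsScalarTower A (FractionRing A) L := IsScalarTower.of_algebraMap_eq fun a => by
    change _ = algebraMap p.ResidueField L (algebraMap (FractionRing A) p.ResidueField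
      (algebraMap A (FractionRing A) a))
    rw [hK]
    rfl
  haveI : FiniteDimensional (FractionRing A) L := Module.Finite.trans p.ResidueField L
  have hinj : Function.Injective (algebraMap A L) := (algebraMap p.ResidueField L).injective.comp hj
  -- `B ⊆ L` finite over `A` with `Frac B = L`, `r₀ x̄ ∈ B`
  obtain ⟨B, hBfin, hBfrac, r₀, hr₀, hx⟩ :=
    exists_finite_subalgebra_isFractionRing A (FractionRing A) L (algebraMap A[X] L X)
  haveI := hBfin
  haveI := hBfrac
  -- `C = S ⊗_{A[x]} B[x]`
  letI : Algebra A[X] B[X] := Polynomial.algebra A B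
  haveI : Module.Finite A[X] B[X] := moduleFinite_polynomial
  letI : Algebra B[X] (S ⊗[A[X]] B[X]) := Algebra.TensorProduct.rightAlgebra
  haveI : IsLocalization (Q.primeCompl.map (Polynomial.mapRingHom (algebraMap A B) : A[X] →+* B[X]))
      (S ⊗[A[X]] B[X]) := IsLocalization.tensorRight S Q.primeCompl
  have hBC : ∀ f : A[X], algebraMap B[X] (S ⊗[A[X]] B[X]) (f.map (algebraMap A B)) =
      algebraMap A[X] (S ⊗[A[X]] B[X]) f := fun f => by
    change (1 : S) ⊗ₜ[A[X]] (f.map (algebraMap A B)) = _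
    rw [Algebra.TensorProduct.algebraMap_apply, Algebra.algebraMap_eq_smul_one (R := A[X]) (A := S),
      smul_tmul, ← Algebra.algebraMap_eq_smul_one (R := A[X]) (A := B[X])]
    rfl
  have key := isRegularRing_tensor_completion_polynomial_of_isLocalization A Q S L B r₀ hr₀ hx hinj
    (hSG L inferInstance) (S ⊗[A[X]] B[X]) hBC
  -- `L ⊗_{κ(𝔭)} (κ(𝔭) ⊗_S Ŝ) = L ⊗_S Ŝ`
  exact IsRegularRing.of_ringEquiv (R := L ⊗[S] AdicCompletion (maximalIdeal S) S)
    (Algebra.TensorProduct.cancelBaseChange S p.ResidueField L L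
      (AdicCompletion (maximalIdeal S) S)).symm.toRingEquiv

end Fibre

/-! ## The kernel `hker` for `𝔯 ≠ 0`, in any characteristic -/

/-- **The kernel `hker` of `GRingPolynomialCoreReduction.lean` for `𝔯 ≠ 0`, in any
characteristic**: for a complete regular local ring `A`, a prime `0 ≠ 𝔯` of `A[x]` with
`𝔯 ∩ A = 0` and a prime `𝔫` of `A[x]/𝔯`, the generic formal fibre of `(A[x]/𝔯)_𝔫` is
geometrically regular (Stacks 07PU through `isGeometricallyRegular_fibre_polynomial_of_ne_bot`,
Stacks 07PR for `A[x]` (`isRegularRing_tensor_completion_polynomial`) and the translation 07PN).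
[cite: StacksProject, Tag 07PU] -/
theorem hasGeomRegularGenericFormalFibre_polynomial_quotient_of_ne_bot (A : Type u) [CommRing A]
    [IsRegularLocalRing A] [IsAdicComplete (maximalIdeal A) A] (r : Ideal A[X]) [r.IsPrime]
    (hr0 : r ≠ ⊥) (hrA : r.under A = ⊥) (n : Ideal (A[X] ⧸ r)) [n.IsPrime] :
    HasGeomRegularGenericFormalFibre (A[X] ⧸ r) n := by
  haveI : IsDomain A := isDomain_of_isRegularLocalRing A
  set Q : Ideal A[X] := n.comap (Ideal.Quotient.mk r) with hQ
  haveI : Q.IsPrime := Ideal.comap_isPrime _ n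
  have hrQ : r ≤ Q := fun x hx => by
    rw [hQ, Ideal.mem_comap, Ideal.Quotient.eq_zero_iff_mem.mpr hx]
    exact n.zero_mem
  have hdisj : Disjoint (Q.primeCompl : Set A[X]) (r : Set A[X]) := by
    rw [Set.disjoint_left]
    exact fun x hx hxr => hx (hrQ hxr)
  set p : Ideal (Localization.AtPrime Q) := r.map (algebraMap A[X] (Localization.AtPrime Q))
  haveI : p.IsPrime :=
    IsLocalization.isPrime_of_isPrime_disjoint Q.primeCompl (Localization.AtPrime Q) r ‹_› hdisj
  have hpr : p.comap (algebraMap A[X] (Localization.AtPrime Q)) = r := by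
    rw [← Ideal.under_def]
    exact IsLocalization.under_map_of_isPrime_disjoint Q.primeCompl _ ‹r.IsPrime› hdisj
  refine hasGeomRegularGenericFormalFibre_quotient_of_fibre Q p r hpr ?_ n hQ
  refine isGeometricallyRegular_fibre_polynomial_of_ne_bot A Q (Localization.AtPrime Q)
    (fun L _ _ _ _ hL => ?_) r hr0 hrA p hpr
  haveI := hL
  exact isRegularRing_tensor_completion_polynomial A Q (FractionRing A) L

end Literature.AlgebraicGeometry.Resolution

end
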